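import Summits.AtomisticToContinuum.Crystallization.Theorems.FrustratedLawDichotomyBornPairTerm

/-!
# FrustratedLawDichotomy · crux `AperiodicFrustratedLawGap` (stmt-AtomisticToContinuum-27623) — BORN STABILITY OF MINIMISING LAWS, II
# (decomp-a2c, prover hand 2, structural share, generation 2)

The second-order content of affine stability.  For `H ∈ End(ℝ³)` and `φ(t) = E_P[Σ_s V_LJ(‖s + tHs‖)]`: `φ` is differentiable near `0`
(`hasDerivAt_meanPairSum_at`, derivative `φ₁(t) = E_P[Σ_s (‖v‖⁻⁸ − ‖v‖⁻¹⁴)⟨v, Hs⟩]`), `φ₁` is differentiable at `0`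
(`hasDerivAt_meanPairDerivSum`, derivative `E_P[Σ_s (14‖s‖⁻¹⁶ − 8‖s‖⁻¹⁰)⟨s, Hs⟩² + (‖s‖⁻⁸ − ‖s‖⁻¹⁴)‖Hs‖²]`), and for a minimiser `t = 0`
is a local minimum of `φ` (transported floor of item 9229 along `1 + tH ∈ GL₃(ℝ)`), so by second-order Fermat:

* `bornStability_of_minimising` — **BORN STABILITY**: granted the floor, every point-stationary `δ`-hard-core probability law with
  `E_P[rootEnergy] ≤ e⋆` has, for EVERY `H ∈ End(ℝ³)`,
  `0 ≤ E_P[Σ_s (14‖s‖⁻¹⁶ − 8‖s‖⁻¹⁰)⟨s, Hs⟩² + (‖s‖⁻⁸ − ‖s‖⁻¹⁴)‖Hs‖²]` — the Palm elastic tensor of an exact Lennard-Jones minimiser among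
  stationary laws is positive semi-definite (mechanical stability under every homogeneous strain).

All `[folklore]`.
-/

noncomputable section

namespace Summit.AtomisticToContinuum.Crystallization.Theorems.FrustratedLawDichotomyPalmStress

open MeasureTheory Metric Set Filter
open scoped ENNReal Topology BigOperators RealInnerProductSpace
open Literature.MathematicalPhysics.StatisticalMechanics Literature.Probability.Process
open Summit.AtomisticToContinuum.Crystallization.Theorems.ChargedEnergyGapNegative (E3 eStar)
open Summit.AtomisticToContinuum.Crystallization.Theorems.FrustratedLawDichotomyLinearImages (eStar_le_integral_linearDeformed)
open Summit.AtomisticToContinuum.Crystallization.Theorems.FrustratedLawDichotomyVirial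
  (integrable_invPow integral_invPow_eq_toReal lintegral_invPow_le_of_isRootedHardCore)

section Law2

variable (H : E3 →L[ℝ] E3) {δ : ℝ} {P : Measure (Measure E3)}

/-- The integral of the second-order dominating function is bounded by the shell bounds. [folklore] -/
theorem norm_integral_pairDeriv2_le {μ : Measure E3} (hδ : 0 < δ) (hμ : IsRootedHardCore δ μ) {t : ℝ} (ht : |t| * ‖H‖ ≤ 1 / 2) :
    ‖∫ s, (14 * ‖s + t • H s‖⁻¹ ^ 16 - 8 * ‖s + t • H s‖⁻¹ ^ 10) * ⟪s + t • H s, H s⟫ ^ 2 +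
        (‖s + t • H s‖⁻¹ ^ 8 - ‖s + t • H s‖⁻¹ ^ 14) * ‖H s‖ ^ 2 ∂μ‖ ≤
      ‖H‖ ^ 2 * (245760 * (250 * δ⁻¹ ^ 6 * δ⁻¹ ^ 6) + 2304 * (250 * δ⁻¹ ^ 6)) := by
  obtain ⟨hi6, hi12⟩ := integrable_invPow hδ hμ
  obtain ⟨he6, he12⟩ := integral_invPow_eq_toReal hδ hμ
  obtain ⟨hl6, hl12⟩ := lintegral_invPow_le_of_isRootedHardCore hδ hμ
  have hb2 : Integrable (fun s : E3 => ‖H‖ ^ 2 * (245760 * ‖s‖⁻¹ ^ 12 + 2304 * ‖s‖⁻¹ ^ 6)) μ :=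
    ((hi12.const_mul _).add (hi6.const_mul _)).const_mul _
  have hm6 : ∫ s, ‖s‖⁻¹ ^ 6 ∂μ ≤ 250 * δ⁻¹ ^ 6 := by
    rw [he6, ← ENNReal.toReal_ofReal (by positivity : (0 : ℝ) ≤ 250 * δ⁻¹ ^ 6)]
    exact ENNReal.toReal_mono ENNReal.ofReal_ne_top hl6
  have hm12 : ∫ s, ‖s‖⁻¹ ^ 12 ∂μ ≤ 250 * δ⁻¹ ^ 6 * δ⁻¹ ^ 6 := by
    rw [he12, ← ENNReal.toReal_ofReal (by positivity : (0 : ℝ) ≤ 250 * δ⁻¹ ^ 6 * δ⁻¹ ^ 6)]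
    exact ENNReal.toReal_mono ENNReal.ofReal_ne_top hl12
  have hH : 0 ≤ ‖H‖ ^ 2 := sq_nonneg _
  refine (norm_integral_le_of_norm_le hb2 (Eventually.of_forall fun s => ?_)).trans ?_
  · rw [Real.norm_eq_abs]; exact pairDeriv2_bound H ht s
  · rw [integral_const_mul, integral_add (hi12.const_mul _) (hi6.const_mul _), integral_const_mul, integral_const_mul]
    exact mul_le_mul_of_nonneg_left (by nlinarith) hH

/-- **The mean deformed root sum is differentiable on the whole ball** `|t| < 1/(2(‖H‖+1))`, with derivative the mean first-derivative
sum. [folklore] -/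
theorem hasDerivAt_meanPairSum_at (hδ : 0 < δ) [IsFiniteMeasure P] (hcore : ∀ᵐ μ ∂P, IsRootedHardCore δ μ) {t₀ : ℝ}
    (ht₀ : t₀ ∈ ball (0 : ℝ) (1 / (2 * (‖H‖ + 1)))) :
    HasDerivAt (fun t : ℝ => ∫ μ, ∫ s, lennardJones ‖s + t • H s‖ ∂μ ∂P)
      (∫ μ, ∫ s, (‖s + t₀ • H s‖⁻¹ ^ 8 - ‖s + t₀ • H s‖⁻¹ ^ 14) * ⟪s + t₀ • H s, H s⟫ ∂μ ∂P) t₀ := by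
  have hball : ball (0 : ℝ) (1 / (2 * (‖H‖ + 1))) ∈ 𝓝 t₀ := isOpen_ball.mem_nhds ht₀
  have hF_meas : ∀ᶠ t in 𝓝 t₀, AEStronglyMeasurable (fun μ : Measure E3 => ∫ s, lennardJones ‖s + t • H s‖ ∂μ) P :=
    Filter.eventually_of_mem hball fun t ht => aestronglyMeasurable_integral (measurable_pairTerms H t).1
      (hcore.mono fun μ hμ => (integrable_pairTerm H hδ hμ (abs_mul_norm_le_half_of_mem_ball H ht)).1)
  have hF_int : Integrable (fun μ : Measure E3 => ∫ s, lennardJones ‖s + t₀ • H s‖ ∂μ) P :=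
    Integrable.of_bound hF_meas.self_of_nhds _ (hcore.mono fun μ hμ =>
      (norm_integral_pairTerm_le H hδ hμ (abs_mul_norm_le_half_of_mem_ball H ht₀)).1)
  have hF'_meas : AEStronglyMeasurable
      (fun μ : Measure E3 => ∫ s, (‖s + t₀ • H s‖⁻¹ ^ 8 - ‖s + t₀ • H s‖⁻¹ ^ 14) * ⟪s + t₀ • H s, H s⟫ ∂μ) P :=
    aestronglyMeasurable_integral (measurable_pairTerms H t₀).2
      (hcore.mono fun μ hμ => (integrable_pairTerm H hδ hμ (abs_mul_norm_le_half_of_mem_ball H ht₀)).2)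
  exact (hasDerivAt_integral_of_dominated_loc_of_deriv_le (μ := P) (x₀ := t₀)
    (F := fun (t : ℝ) (μ : Measure E3) => ∫ s, lennardJones ‖s + t • H s‖ ∂μ)
    (F' := fun (t : ℝ) (μ : Measure E3) => ∫ s, (‖s + t • H s‖⁻¹ ^ 8 - ‖s + t • H s‖⁻¹ ^ 14) * ⟪s + t • H s, H s⟫ ∂μ)
    (bound := fun _ : Measure E3 => ‖H‖ * (2 ^ 13 * (250 * δ⁻¹ ^ 6 * δ⁻¹ ^ 6) + 2 ^ 7 * (250 * δ⁻¹ ^ 6))) hball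
    hF_meas hF_int hF'_meas
    (hcore.mono fun μ hμ t ht => (norm_integral_pairTerm_le H hδ hμ (abs_mul_norm_le_half_of_mem_ball H ht)).2)
    (integrable_const _)
    (hcore.mono fun μ hμ t ht => hasDerivAt_pairSum H hδ hμ ht)).2

/-- **The mean first-derivative sum is differentiable at `0`**, with derivative the mean second-derivative sum
`E_P[Σ_s (14‖s‖⁻¹⁶ − 8‖s‖⁻¹⁰)⟨s, Hs⟩² + (‖s‖⁻⁸ − ‖s‖⁻¹⁴)‖Hs‖²]`. [folklore] -/
theorem hasDerivAt_meanPairDerivSum (hδ : 0 < δ) [IsFiniteMeasure P] (hcore : ∀ᵐ μ ∂P, IsRootedHardCore δ μ) :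
    HasDerivAt (fun t : ℝ => ∫ μ, ∫ s, (‖s + t • H s‖⁻¹ ^ 8 - ‖s + t • H s‖⁻¹ ^ 14) * ⟪s + t • H s, H s⟫ ∂μ ∂P)
      (∫ μ, ∫ s, (14 * ‖s‖⁻¹ ^ 16 - 8 * ‖s‖⁻¹ ^ 10) * ⟪s, H s⟫ ^ 2 + (‖s‖⁻¹ ^ 8 - ‖s‖⁻¹ ^ 14) * ‖H s‖ ^ 2 ∂μ ∂P) 0 := by
  have hε0 : 0 < 1 / (2 * (‖H‖ + 1)) := by positivity
  have hball : ball (0 : ℝ) (1 / (2 * (‖H‖ + 1))) ∈ 𝓝 (0 : ℝ) := ball_mem_nhds 0 hε0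
  have h0mem : (0 : ℝ) ∈ ball (0 : ℝ) (1 / (2 * (‖H‖ + 1))) := mem_ball_self hε0
  have hF_meas : ∀ᶠ t in 𝓝 (0 : ℝ), AEStronglyMeasurable
      (fun μ : Measure E3 => ∫ s, (‖s + t • H s‖⁻¹ ^ 8 - ‖s + t • H s‖⁻¹ ^ 14) * ⟪s + t • H s, H s⟫ ∂μ) P :=
    Filter.eventually_of_mem hball fun t ht => aestronglyMeasurable_integral (measurable_pairTerms H t).2
      (hcore.mono fun μ hμ => (integrable_pairTerm H hδ hμ (abs_mul_norm_le_half_of_mem_ball H ht)).2)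
  have hF_int : Integrable
      (fun μ : Measure E3 => ∫ s, (‖s + (0 : ℝ) • H s‖⁻¹ ^ 8 - ‖s + (0 : ℝ) • H s‖⁻¹ ^ 14) * ⟪s + (0 : ℝ) • H s, H s⟫ ∂μ) P :=
    Integrable.of_bound hF_meas.self_of_nhds _ (hcore.mono fun μ hμ =>
      (norm_integral_pairTerm_le H hδ hμ (abs_mul_norm_le_half_of_mem_ball H h0mem)).2)
  have hF'_meas : AEStronglyMeasurable
      (fun μ : Measure E3 => ∫ s, (14 * ‖s + (0 : ℝ) • H s‖⁻¹ ^ 16 - 8 * ‖s + (0 : ℝ) • H s‖⁻¹ ^ 10) * ⟪s + (0 : ℝ) • H s, H s⟫ ^ 2 +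
        (‖s + (0 : ℝ) • H s‖⁻¹ ^ 8 - ‖s + (0 : ℝ) • H s‖⁻¹ ^ 14) * ‖H s‖ ^ 2 ∂μ) P :=
    aestronglyMeasurable_integral (measurable_pairDeriv2 H 0)
      (hcore.mono fun μ hμ => (hasDerivAt_pairDerivSum H hδ hμ h0mem).1)
  have key := hasDerivAt_integral_of_dominated_loc_of_deriv_le (μ := P) (x₀ := (0 : ℝ))
    (F := fun (t : ℝ) (μ : Measure E3) => ∫ s, (‖s + t • H s‖⁻¹ ^ 8 - ‖s + t • H s‖⁻¹ ^ 14) * ⟪s + t • H s, H s⟫ ∂μ)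
    (F' := fun (t : ℝ) (μ : Measure E3) => ∫ s, (14 * ‖s + t • H s‖⁻¹ ^ 16 - 8 * ‖s + t • H s‖⁻¹ ^ 10) * ⟪s + t • H s, H s⟫ ^ 2 +
        (‖s + t • H s‖⁻¹ ^ 8 - ‖s + t • H s‖⁻¹ ^ 14) * ‖H s‖ ^ 2 ∂μ)
    (bound := fun _ : Measure E3 => ‖H‖ ^ 2 * (245760 * (250 * δ⁻¹ ^ 6 * δ⁻¹ ^ 6) + 2304 * (250 * δ⁻¹ ^ 6))) hball
    hF_meas hF_int hF'_meas
    (hcore.mono fun μ hμ t ht => norm_integral_pairDeriv2_le H hδ hμ (abs_mul_norm_le_half_of_mem_ball H ht))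
    (integrable_const _)
    (hcore.mono fun μ hμ t ht => (hasDerivAt_pairDerivSum H hδ hμ ht).2)
  have h := key.2
  simp only [zero_smul, add_zero] at h
  exact h

end Law2

/-! ## Born stability -/

section Born

variable {δ : ℝ} {P : Measure (Measure E3)}

/-- **BORN STABILITY OF MINIMISING LAWS.**  Granted the energy floor for point-stationary hard-core probability laws (item 9229, hypothesis
`hU`), every point-stationary `δ`-hard-core probability law `P` with `E_P[rootEnergy] ≤ e⋆` satisfies, for EVERY `H ∈ End(ℝ³)`,
`0 ≤ E_P[Σ_s (14‖s‖⁻¹⁶ − 8‖s‖⁻¹⁰)⟨s, Hs⟩² + (‖s‖⁻⁸ − ‖s‖⁻¹⁴)‖Hs‖²]`: the second variation of the mean energy along `1 + tH` is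
non-negative (second-order Fermat at the minimum `t = 0` of `t ↦ E_P[Σ V_LJ(‖s + tHs‖)] ≥ 2e⋆`). [folklore] -/
theorem bornStability_of_minimising
    (hU : ∀ δ' : ℝ, 0 < δ' → ∀ Q : Measure (Measure E3), IsProbabilityMeasure Q → (∀ᵐ μ ∂Q, IsRootedHardCore δ' μ) →
      IsPointStationaryLaw Q → eStar ≤ ∫ μ, rootEnergy lennardJones μ ∂Q)
    (hδ : 0 < δ) [IsProbabilityMeasure P] (hcore : ∀ᵐ μ ∂P, IsRootedHardCore δ μ) (hstat : IsPointStationaryLaw P)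
    (hmin : ∫ μ, rootEnergy lennardJones μ ∂P ≤ eStar) (H : E3 →L[ℝ] E3) :
    0 ≤ ∫ μ, ∫ s, (14 * ‖s‖⁻¹ ^ 16 - 8 * ‖s‖⁻¹ ^ 10) * ⟪s, H s⟫ ^ 2 + (‖s‖⁻¹ ^ 8 - ‖s‖⁻¹ ^ 14) * ‖H s‖ ^ 2 ∂μ ∂P := by
  have hε0 : 0 < 1 / (2 * (‖H‖ + 1)) := by positivity
  have hball : ball (0 : ℝ) (1 / (2 * (‖H‖ + 1))) ∈ 𝓝 (0 : ℝ) := ball_mem_nhds 0 hε0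
  set φ : ℝ → ℝ := fun t => ∫ μ, ∫ s, lennardJones ‖s + t • H s‖ ∂μ ∂P with hφ
  -- the floor transported along `1 + tH ∈ GL₃(ℝ)`
  have hfloor : ∀ t ∈ ball (0 : ℝ) (1 / (2 * (‖H‖ + 1))), 2 * eStar ≤ φ t := by
    intro t ht
    have ht' := abs_mul_norm_le_half_of_mem_ball H ht
    set L : E3 →ₗ[ℝ] E3 := LinearMap.id + t • (H : E3 →ₗ[ℝ] E3) with hL
    have hLapply : ∀ s, L s = s + t • H s := fun s => by simp [hL]
    have hLinj : Function.Injective L := by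
      intro x y hxy
      by_contra hne
      have hpos : 0 < ‖x - y‖ := norm_pos_iff.2 (sub_ne_zero.2 hne)
      have hlo := (norm_deformed_bounds H ht' (x - y)).1
      have h0 : L (x - y) = 0 := by rw [map_sub, hxy, sub_self]
      rw [hLapply] at h0
      rw [h0, norm_zero] at hlo
      linarith
    set A : E3 ≃L[ℝ] E3 := (LinearEquiv.ofInjectiveEndo L hLinj).toContinuousLinearEquiv with hA
    have hAapply : ∀ s, A s = s + t • H s := fun s => by simp [hA, hL]
    have h := eStar_le_integral_linearDeformed hU hδ hcore hstat A
    simp only [hAapply] at h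
    rw [integral_div] at h
    have : (∫ μ, ∫ y, lennardJones ‖y + t • H y‖ ∂μ ∂P) = φ t := rfl
    linarith
  have hφ0 : φ 0 = 2 * ∫ μ, rootEnergy lennardJones μ ∂P := by
    simp only [hφ, zero_smul, add_zero]
    rw [← integral_const_mul]
    refine integral_congr_ae (Eventually.of_forall fun μ => ?_)
    simp only [rootEnergy_def]
    ring
  have hlocmin : IsLocalMin φ 0 :=
    Filter.eventually_of_mem hball fun t ht => by rw [hφ0]; linarith [hfloor t ht]
  exact second_deriv_nonneg_of_isLocalMin hε0 hlocmin (fun t ht => hasDerivAt_meanPairSum_at H hδ hcore ht)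
    (hasDerivAt_meanPairDerivSum H hδ hcore)

/-- **Trace-free reading (shear stability).**  With `H = 1` the Born integrand is `14‖s‖⁻¹² − 8‖s‖⁻⁶ + ‖s‖⁻⁶ − ‖s‖⁻¹² = 13‖s‖⁻¹² − 7‖s‖⁻⁶`
pointwise (`s ≠ 0`), so dilation stability reads `E_P[Σ (13‖s‖⁻¹² − 7‖s‖⁻⁶)] ≥ 0` — automatic from the virial identity
`E Σ‖s‖⁻⁶ = E Σ‖s‖⁻¹²`; the new content of Born stability is in the trace-free `H`. [folklore] -/
theorem born_trace_integrand {s : E3} (hs : s ≠ 0) :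
    (14 * ‖s‖⁻¹ ^ 16 - 8 * ‖s‖⁻¹ ^ 10) * ⟪s, (1 : E3 →L[ℝ] E3) s⟫ ^ 2 + (‖s‖⁻¹ ^ 8 - ‖s‖⁻¹ ^ 14) * ‖(1 : E3 →L[ℝ] E3) s‖ ^ 2 =
      13 * ‖s‖⁻¹ ^ 12 - 7 * ‖s‖⁻¹ ^ 6 := by
  change (14 * ‖s‖⁻¹ ^ 16 - 8 * ‖s‖⁻¹ ^ 10) * ⟪s, s⟫ ^ 2 + (‖s‖⁻¹ ^ 8 - ‖s‖⁻¹ ^ 14) * ‖s‖ ^ 2 = _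
  rw [real_inner_self_eq_norm_sq]
  have ha : ‖s‖ ≠ 0 := norm_ne_zero_iff.2 hs
  field_simp
  ring

end Born

end Summit.AtomisticToContinuum.Crystallization.Theorems.FrustratedLawDichotomyPalmStress

end
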